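import Summits.QuantumFields.YangMills.Theorems.LangevinControlUVOSLegsFromFemtoAndGapStubAssemblyPlaneStrings
import Summits.QuantumFields.YangMills.Theorems.LangevinControlUVOSLegsFromFemtoAndGapStubAssemblyShiftDefect
import HarnessLib

/-!
# Soft OS-assembly toolkit XIV-b: plane strings — the shifted bound AND the shift defect with one set of constants

Helper file for stub `stub_assembly6` of crux `OSLegsFromFemtoAndGap` (stmt-QuantumFields-9367, line
`dlr-collar-transfer`, reshape r2).  The reflection-positivity blocks need, along ONE scheme, both the a-uniform bound
for plane strings at shifted points (toolkit XIV) and the `O(a)` shift defect (toolkit XVI) — with constants obtained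
from `MomentBounds6` ONCE (`exists_planeString_bounds`), so that a single threshold `β₄` governs the scheme.
-/

noncomputable section

open scoped SchwartzMap BigOperators
open MeasureTheory Filter Topology
open Literature.MathematicalPhysics.QuantumFieldTheory Literature.MathematicalPhysics.QuantumLattice
open Literature.MathematicalPhysics.AQFT
open Literature.Probability.LatticeModels (box Site)
open Summit.QuantumFields.YangMills.Cruxes.OSLegsFromFemtoAndGap.DlrCollarTransfer (plane MomentBounds6 exists_abs_plane_le)

namespace Summit.QuantumFields.YangMills.Theorems.OSLegsFromFemtoAndGap

local notation "E4" => EuclideanSpace ℝ (Fin 4)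

variable {G : Type} [Group G] [TopologicalSpace G] [IsTopologicalGroup G] [CompactSpace G]
  [MeasurableSpace G] [BorelSpace G]

/-- **Plane-string bounds from `MomentBounds6`, one set of constants.**  For `β ≥ β₄`, `0 < a β ≤ min (1/24) ℓ₄`,
`L ≥ 14`, `L ≥ a⁻²`, `n ≥ 2`, valid plane strings `q`, `F ∈ ⁰𝒮ₙ`:
(i) the a-uniform bound at any evaluation points within six lattice units;
(ii) the shift defect at the lattice points for shifts `c`, `‖c_l‖ ≤ a β`:
`‖Σₓ W(x)(F(a x + c) − F(a x))‖ ≤ 2‖c‖ Kⁿ Σ⁺(F)`. -/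
theorem exists_planeString_bounds (r : LatticeRep G) {a : ℝ → ℝ} (hMB : MomentBounds6 G r a) :
    ∃ (β₄ ℓ₄ K : ℝ), 0 < ℓ₄ ∧ 0 ≤ K ∧ ∀ β : ℝ, β₄ ≤ β → 0 < a β → a β ≤ 1 / 24 → a β ≤ ℓ₄ →
      ∀ L : ℕ, 14 ≤ L → (a β)⁻¹ * (a β)⁻¹ ≤ L →
      ∀ n : ℕ, 2 ≤ n → ∀ q : Fin n → Fin 4 × Fin 4, (∀ i, (q i).1 < (q i).2) →
      ∀ F : 𝓢((Fin n → E4), ℂ), IsOffDiagonal F →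
      (∀ y : (Fin n → Site 4) → (Fin n → E4), (∀ x l, ‖y x l - a β • siteToE (x l)‖ ≤ 6 * a β) →
        ‖∑ x ∈ Fintype.piFinset (fun _ : Fin n => box 4 L),
            ((torusMomentStr r.ρ β L (fun i U => plaquetteObs r.ρ 0 (q i).1 (q i).2 U)
              (fun i => wilsonTorusMean r.ρ β L (fun U => plaquetteObs r.ρ 0 (q i).1 (q i).2 U)) x : ℝ) : ℂ) *
            F (y x)‖ ≤
          K ^ n * (SchwartzMap.seminorm ℂ 0 (4 * n) F + SchwartzMap.seminorm ℂ (6 * n) (4 * n) F +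
            SchwartzMap.seminorm ℂ 0 0 F + SchwartzMap.seminorm ℂ (6 * n) 0 F + SchwartzMap.seminorm ℂ (10 * n) 0 F)) ∧
      (∀ c : Fin n → E4, (∀ l, ‖c l‖ ≤ a β) →
        ‖∑ x ∈ Fintype.piFinset (fun _ : Fin n => box 4 L),
            ((torusMomentStr r.ρ β L (fun i U => plaquetteObs r.ρ 0 (q i).1 (q i).2 U)
              (fun i => wilsonTorusMean r.ρ β L (fun U => plaquetteObs r.ρ 0 (q i).1 (q i).2 U)) x : ℝ) : ℂ) *
            (F ((fun l => a β • siteToE (x l)) + c) - F (fun l => a β • siteToE (x l)))‖ ≤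
          2 * ‖c‖ * K ^ n * (SchwartzMap.seminorm ℂ 0 (4 * n + 1) F + SchwartzMap.seminorm ℂ (6 * n) (4 * n + 1) F +
            SchwartzMap.seminorm ℂ 0 1 F + SchwartzMap.seminorm ℂ (6 * n) 1 F + SchwartzMap.seminorm ℂ (10 * n) 1 F)) := by
  obtain ⟨C, β₄, ℓ₄, hℓ, hC, H⟩ := abs_torusMomentStr_plane_le_of_momentBounds6 r hMB
  obtain ⟨Cp, hCp⟩ := exists_abs_plane_le (G := G) r
  have hCp0 : 0 ≤ Cp := le_trans (abs_nonneg _) (hCp (0, 1) 0 (fun _ => 1))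
  set M : ℝ := Cp + Cp with hM
  have hM0 : 0 ≤ M := by positivity
  -- the constant of toolkit X at shift radius `s = 6` dominates the one at `s = 1`
  set K : ℝ := (M * 4 ^ 4 * 5 ^ 6 + M * 2 ^ 6 * (10 + 2 * 6) ^ 4 + 16 * C * 2 ^ 6 * (2 / ℓ₄ + 48) ^ 4) * 2 ^ 6 *
      (81 * ∑' m : ℕ, (((m : ℝ) + 1) ^ 2)⁻¹) with hK
  have hZ0 : 0 ≤ ∑' m : ℕ, (((m : ℝ) + 1) ^ 2)⁻¹ := tsum_nonneg fun m => by positivity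
  have hK0 : 0 ≤ K := by rw [hK]; positivity
  have hK1 : (M * 4 ^ 4 * 5 ^ 6 + M * 2 ^ 6 * (10 + 2 * (0 + 1)) ^ 4 + 16 * C * 2 ^ 6 * (2 / ℓ₄ + 48) ^ 4) * 2 ^ 6 *
      (81 * ∑' m : ℕ, (((m : ℝ) + 1) ^ 2)⁻¹) ≤ K := by
    rw [hK]
    have h2ℓ : 0 < 2 / ℓ₄ := div_pos two_pos hℓ
    gcongr
    norm_num
  refine ⟨β₄, ℓ₄, K, hℓ, hK0, ?_⟩
  intro β hβ ha ha24 haℓ L hL14 hLa n hn q hq F hF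
  have ha1 : a β ≤ 1 := ha24.trans (by norm_num)
  refine ⟨fun y hyx => ?_, fun c hc => ?_⟩
  · have hsa : 6 * a β ≤ 1 / 4 := by linarith
    have h := norm_sum_weight_mul_le hℓ hC hM0 _ (fun x => abs_torusMomentStr_plane_le r hCp β L q x)
      (fun x R hR hRa hRL hsep => H β hβ L n q x R hq hR hRa hRL hsep) ha ha1 haℓ hL14 hLa hn (by norm_num) le_rfl hsa
      F hF y hyx
    rw [← hK] at h; exact h
  · have hsa : (0 + 1) * a β ≤ 1 / 4 := by linarith
    have h := norm_sum_weight_shift_sub_le hℓ hC hM0 _ (fun x => abs_torusMomentStr_plane_le r hCp β L q x)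
      (fun x R hR hRa hRL hsep => H β hβ L n q x R hq hR hRa hRL hsep) ha ha1 haℓ hL14 hLa hn le_rfl zero_le_one
      (by norm_num) hsa F hF (fun x l => a β • siteToE (x l)) (fun x l => by
        rw [sub_self, norm_zero]; exact mul_nonneg le_rfl ha.le) c (fun l => by rw [one_mul]; exact hc l)
    refine h.trans ?_
    have hS : 0 ≤ SchwartzMap.seminorm ℂ 0 (4 * n + 1) F + SchwartzMap.seminorm ℂ (6 * n) (4 * n + 1) F +
        SchwartzMap.seminorm ℂ 0 1 F + SchwartzMap.seminorm ℂ (6 * n) 1 F + SchwartzMap.seminorm ℂ (10 * n) 1 F := by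
      positivity
    have hpow := pow_le_pow_left₀ (by positivity) hK1 n
    calc _ = 2 * ‖c‖ * ((M * 4 ^ 4 * 5 ^ 6 + M * 2 ^ 6 * (10 + 2 * (0 + 1)) ^ 4 + 16 * C * 2 ^ 6 * (2 / ℓ₄ + 48) ^ 4) *
          2 ^ 6 * (81 * ∑' m : ℕ, (((m : ℝ) + 1) ^ 2)⁻¹)) ^ n *
          (SchwartzMap.seminorm ℂ 0 (4 * n + 1) F + SchwartzMap.seminorm ℂ (6 * n) (4 * n + 1) F +
            SchwartzMap.seminorm ℂ 0 1 F + SchwartzMap.seminorm ℂ (6 * n) 1 F + SchwartzMap.seminorm ℂ (10 * n) 1 F) := by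
          ring
      _ ≤ 2 * ‖c‖ * K ^ n * (SchwartzMap.seminorm ℂ 0 (4 * n + 1) F + SchwartzMap.seminorm ℂ (6 * n) (4 * n + 1) F +
            SchwartzMap.seminorm ℂ 0 1 F + SchwartzMap.seminorm ℂ (6 * n) 1 F + SchwartzMap.seminorm ℂ (10 * n) 1 F) := by
          gcongr

end Summit.QuantumFields.YangMills.Theorems.OSLegsFromFemtoAndGap

end
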